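import Mathlib

/-!
# The shell-block bookkeeping of a 3-L (Lyapunov skew-cut) certificate — D2-CHAIN-MAP step S8 (cap g6, cell `ns-blowup`, 2026-08-26)

HONEST FRAMING (human ruling D-0035): nothing here is a claim about Navier–Stokes blow-up.
WHAT THIS IS NOT: not NS evidence. This file types the one sentence of the D2 certificate's
inequality chain (`HOME/cap/D2-CHAIN-MAP.md`, step S8; `d2_cert.py` docstring «⇒ HYPOTHESIS (L)»)
that was still prose after cap g3–g5's kernels: the **bookkeeping** by which a certified head block,
a certified head∣tail cross bound and an analytic tail form assemble into hypothesis (L)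
`Re⟪G w, A w⟫ ≤ ω · Re⟪G w, w⟫` of THEOREM 3-L
(`Summit.NavierStokesRegularity.FluidComputer.LyapunovSkewCutSemigroup.norm_le_of_generator_form`,
instab g11, p416235), for every `w` of the domain.

ABSTRACT SETTING (any inner-product space `E` over `𝕜 = ℝ` or `ℂ`). The space carries four pairwise
orthogonal pieces — interior head `Ki` (cube shells `< K`), last head shell `Kk` (shell `K`), first
tail shell `Ks` (shell `K+1`) and deep tail `Kd` (shells `≥ K+2`) — and a vector
`w = i + k + s + d` with `i ∈ Ki`, `k ∈ Kk`, `s ∈ Ks`, `d ∈ Kd`. The weight is BLOCK DIAGONAL: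
`G w = Gᵢ i + W k + τ (s + d)` with `Gᵢ Ki ⊆ Ki`, `W Kk ⊆ Kk` (the D2 driver's «G = diag over units
…; the infinite tail carries τ»). The generator `A` is NEAREST-SHELL LOCAL: `⟪x, A y⟫ = 0` whenever
`x, y` lie in two pieces that are not adjacent in the chain `Ki — Kk — Ks — Kd` (the tree theorems
`CubeShellAdjacency.shell_window_of_unit` p433046 and `ShellCouplingSupport.mFourierCoeff_convect_abcFlow_eq_zero`
p435584 are exactly this for the linearisation about `Torus.abcFlow 1 1 1` on cube shells).

* `re_inner_weight_apply_eq` — the IDENTITY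
  `Re⟪G w, A w⟫ = Re⟪Gₕ h, A h⟫ + (Re⟪W k, A s⟫ + τ Re⟪s, A k⟫) + τ Re⟪t, A t⟫`
  with `h = i + k`, `Gₕ h = Gᵢ i + W k`, `t = s + d`: the cross term sees ONLY the last head shell and
  the first tail shell, and the deep tail `d` sees ONLY the tail form («`y_{≥K+2}` only sees the tail
  form»).
* `re_inner_weight_self_eq` — `Re⟪G w, w⟫ = Re⟪Gₕ h, h⟫ + τ‖t‖²`, and `norm_sq_tail_eq` —
  `‖t‖² = ‖s‖² + ‖d‖²`.
* `neg_quad_add_cross_nonpos` — the elementary absorption with the NON-STRICT pivot condition: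
  `0 ≤ p`, `0 ≤ q`, `b² ≤ 4 p q` ⇒ `−p a² + b a c − q c² ≤ 0` (so the D2 correction
  `corr = b²/(4 τ η_t)` may be used with equality).
* `re_inner_weight_generator_le` — HYPOTHESIS (L) ASSEMBLED: if the head form obeys
  `Re⟪Gₕ h, A h⟫ − ω Re⟪Gₕ h, h⟫ ≤ −ηₕ ‖k‖²` (the certified `N′ ≽ 0` with `ηₕ = corr`), the cross
  term obeys `|Re⟪W k, A s⟫ + τ Re⟪s, A k⟫| ≤ b ‖k‖ ‖s‖` (the certified ball Gram bound), the tail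
  form obeys `Re⟪t, A t⟫ − ω ‖t‖² ≤ −ηₜ ‖t‖²` on the whole tail (the analytic levels, kernel
  `AbcFlowCubeTailForms` p437370), and `0 ≤ τ`, `0 ≤ ηₕ`, `0 ≤ ηₜ`, `b² ≤ 4 ηₕ (τ ηₜ)`, then
  `Re⟪G w, A w⟫ ≤ ω · Re⟪G w, w⟫` — literally the `hL` of `norm_le_of_generator_form`.

Mathlib only; no new definitions; std axioms.
-/

noncomputable section

namespace Summit.NavierStokesRegularity.FluidComputer.ShellBlockLyapunovForm

open RCLike
open scoped InnerProductSpace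

variable {𝕜 E : Type*} [RCLike 𝕜] [NormedAddCommGroup E] [InnerProductSpace 𝕜 E]

section Elementary

/-- **Absorption with a non-strict pivot.** If `0 ≤ p`, `0 ≤ q` and `b² ≤ 4 p q` then the
two-variable form `−p a² + b a c − q c²` is non-positive (the matrix `[[−p, b/2], [b/2, −q]]` is
negative semidefinite). With `p = b²/(4q)` this is the D2 driver's completed square
`−q (c − (b/(2q)) a)²`. -/
theorem neg_quad_add_cross_nonpos {p q b a c : ℝ} (hp : 0 ≤ p) (hq : 0 ≤ q)
    (hb : b ^ 2 ≤ 4 * p * q) : -p * a ^ 2 + b * a * c - q * c ^ 2 ≤ 0 := by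
  rcases hp.eq_or_lt with hp0 | hp0
  · -- `p = 0` forces `b = 0`
    have hb0 : b = 0 := by
      have : b ^ 2 ≤ 0 := by simpa [← hp0] using hb
      exact pow_eq_zero_iff (n := 2) (by norm_num) |>.mp (le_antisymm this (sq_nonneg b))
    subst hb0
    rw [← hp0]
    nlinarith [sq_nonneg c]
  · -- `p > 0`: `4p · (form) = −(2pa − bc)² + (b² − 4pq) c² ≤ 0`
    have key : 4 * p * (-p * a ^ 2 + b * a * c - q * c ^ 2) =
        -(2 * p * a - b * c) ^ 2 + (b ^ 2 - 4 * p * q) * c ^ 2 := by ring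
    have h4 : 4 * p * (-p * a ^ 2 + b * a * c - q * c ^ 2) ≤ 0 := by
      rw [key]
      nlinarith [sq_nonneg (2 * p * a - b * c), sq_nonneg c]
    nlinarith [h4, hp0]

/-- `Re⟪(τ : 𝕜) • x, y⟫ = τ · Re⟪x, y⟫` for a real scalar `τ`. -/
theorem re_inner_ofReal_smul_left (τ : ℝ) (x y : E) :
    re ⟪((τ : 𝕜) • x), y⟫_𝕜 = τ * re ⟪x, y⟫_𝕜 := by
  rw [inner_smul_left, conj_ofReal, re_ofReal_mul]

/-- **Pythagoras on the tail:** `‖s + d‖² = ‖s‖² + ‖d‖²` when `⟪s, d⟫ = 0`. -/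
theorem norm_sq_tail_eq {s d : E} (hsd : ⟪s, d⟫_𝕜 = 0) :
    ‖s + d‖ ^ 2 = ‖s‖ ^ 2 + ‖d‖ ^ 2 := by
  have := norm_add_sq_eq_norm_sq_add_norm_sq_of_inner_eq_zero s d hsd
  nlinarith [this]

end Elementary

section Bookkeeping

variable {Ki Kk Ks Kd : Submodule 𝕜 E}

/-- **The weight against the vector (S2's form): `Re⟪G w, w⟫ = Re⟪Gₕ h, h⟫ + τ ‖t‖²`.** Here
`w = i + k + s + d`, `h = i + k`, `t = s + d`, `G w = Gᵢ i + W k + τ t` with `Gᵢ i ∈ Ki`,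
`W k ∈ Kk`, and the head pieces are orthogonal to the tail pieces. -/
theorem re_inner_weight_self_eq
    (h_is : Ki ⟂ Ks) (h_id : Ki ⟂ Kd) (h_ks : Kk ⟂ Ks) (h_kd : Kk ⟂ Kd)
    {Gi W : E →ₗ[𝕜] E} (hGi : ∀ x ∈ Ki, Gi x ∈ Ki) (hW : ∀ x ∈ Kk, W x ∈ Kk) (τ : ℝ)
    {i k s d : E} (hi : i ∈ Ki) (hk : k ∈ Kk) (hs : s ∈ Ks) (hd : d ∈ Kd) :
    re ⟪Gi i + W k + ((τ : 𝕜) • (s + d)), i + k + s + d⟫_𝕜 =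
      re ⟪Gi i + W k, i + k⟫_𝕜 + τ * ‖s + d‖ ^ 2 := by
  -- orthogonality facts used
  have o1 : ⟪Gi i, s⟫_𝕜 = 0 := h_is.inner_eq (hGi i hi) hs
  have o2 : ⟪Gi i, d⟫_𝕜 = 0 := h_id.inner_eq (hGi i hi) hd
  have o3 : ⟪W k, s⟫_𝕜 = 0 := h_ks.inner_eq (hW k hk) hs
  have o4 : ⟪W k, d⟫_𝕜 = 0 := h_kd.inner_eq (hW k hk) hd
  have o5 : ⟪s, i⟫_𝕜 = 0 := h_is.symm.inner_eq hs hi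
  have o6 : ⟪d, i⟫_𝕜 = 0 := h_id.symm.inner_eq hd hi
  have o7 : ⟪s, k⟫_𝕜 = 0 := h_ks.symm.inner_eq hs hk
  have o8 : ⟪d, k⟫_𝕜 = 0 := h_kd.symm.inner_eq hd hk
  have e1 : ⟪Gi i + W k + ((τ : 𝕜) • (s + d)), i + k + s + d⟫_𝕜 =
      ⟪Gi i + W k, i + k⟫_𝕜 + ⟪((τ : 𝕜) • (s + d)), s + d⟫_𝕜 := by
    simp only [inner_add_left, inner_add_right, inner_smul_left, o1, o2, o3, o4, o5, o6, o7, o8]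
    ring
  rw [e1, AddMonoidHom.map_add, re_inner_ofReal_smul_left, inner_self_eq_norm_sq]

/-- **The bookkeeping identity (D2-CHAIN-MAP S8).** With `w = i + k + s + d` (interior head, last
head shell, first tail shell, deep tail — NO orthogonality is needed for this identity), block-diagonal weight
`G w = Gᵢ i + W k + τ (s + d)` (`Gᵢ Ki ⊆ Ki`, `W Kk ⊆ Kk`) and a nearest-shell-local generator
`A` (no coupling `Ki ↔ Ks`, `Ki ↔ Kd`, `Kk ↔ Kd` in either direction), the weighted generator form
splits as HEAD + CROSS + TAIL:
`Re⟪G w, A w⟫ = Re⟪Gᵢ i + W k, A (i + k)⟫ + (Re⟪W k, A s⟫ + τ Re⟪s, A k⟫) + τ Re⟪s + d, A (s + d)⟫`.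
The cross term involves only the last head shell `k` and the first tail shell `s`; the deep tail
`d` enters only through the tail form. -/
theorem re_inner_weight_apply_eq
    {A Gi W : E →ₗ[𝕜] E} (hGi : ∀ x ∈ Ki, Gi x ∈ Ki) (hW : ∀ x ∈ Kk, W x ∈ Kk)
    (hA_id : ∀ x ∈ Ki, ∀ y ∈ Kd, ⟪x, A y⟫_𝕜 = 0) (hA_di : ∀ x ∈ Kd, ∀ y ∈ Ki, ⟪x, A y⟫_𝕜 = 0)
    (hA_kd : ∀ x ∈ Kk, ∀ y ∈ Kd, ⟪x, A y⟫_𝕜 = 0) (hA_dk : ∀ x ∈ Kd, ∀ y ∈ Kk, ⟪x, A y⟫_𝕜 = 0)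
    (hA_is : ∀ x ∈ Ki, ∀ y ∈ Ks, ⟪x, A y⟫_𝕜 = 0) (hA_si : ∀ x ∈ Ks, ∀ y ∈ Ki, ⟪x, A y⟫_𝕜 = 0)
    (τ : ℝ) {i k s d : E} (hi : i ∈ Ki) (hk : k ∈ Kk) (hs : s ∈ Ks) (hd : d ∈ Kd) :
    re ⟪Gi i + W k + ((τ : 𝕜) • (s + d)), A (i + k + s + d)⟫_𝕜 =
      re ⟪Gi i + W k, A (i + k)⟫_𝕜 + (re ⟪W k, A s⟫_𝕜 + τ * re ⟪s, A k⟫_𝕜)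
        + τ * re ⟪s + d, A (s + d)⟫_𝕜 := by
  -- locality facts used
  have l1 : ⟪Gi i, A s⟫_𝕜 = 0 := hA_is _ (hGi i hi) _ hs
  have l2 : ⟪Gi i, A d⟫_𝕜 = 0 := hA_id _ (hGi i hi) _ hd
  have l3 : ⟪W k, A d⟫_𝕜 = 0 := hA_kd _ (hW k hk) _ hd
  have l4 : ⟪s, A i⟫_𝕜 = 0 := hA_si _ hs _ hi
  have l5 : ⟪d, A i⟫_𝕜 = 0 := hA_di _ hd _ hi
  have l6 : ⟪d, A k⟫_𝕜 = 0 := hA_dk _ hd _ hk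
  have hw : A (i + k + s + d) = A (i + k) + A s + A d := by
    rw [show i + k + s + d = (i + k) + s + d by abel, map_add, map_add]
  -- head weight against everything
  have eH : ⟪Gi i + W k, A (i + k + s + d)⟫_𝕜 = ⟪Gi i + W k, A (i + k)⟫_𝕜 + ⟪W k, A s⟫_𝕜 := by
    rw [hw, inner_add_right, inner_add_right, inner_add_left (Gi i) (W k) (A s),
      inner_add_left (Gi i) (W k) (A d), l1, l2, l3]
    ring
  -- tail weight against everything
  have eT : ⟪s + d, A (i + k + s + d)⟫_𝕜 = ⟪s, A k⟫_𝕜 + ⟪s + d, A (s + d)⟫_𝕜 := by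
    have hw' : A (i + k + s + d) = A i + A k + A (s + d) := by
      rw [show i + k + s + d = i + k + (s + d) by abel, map_add, map_add]
    rw [hw', inner_add_right, inner_add_right, inner_add_left s d (A i), inner_add_left s d (A k),
      l4, l5, l6]
    ring
  have e : ⟪Gi i + W k + ((τ : 𝕜) • (s + d)), A (i + k + s + d)⟫_𝕜 =
      ⟪Gi i + W k, A (i + k)⟫_𝕜 + ⟪W k, A s⟫_𝕜 +
        (τ : 𝕜) * (⟪s, A k⟫_𝕜 + ⟪s + d, A (s + d)⟫_𝕜) := by
    rw [inner_add_left, eH, inner_smul_left, conj_ofReal, eT]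
  rw [e, AddMonoidHom.map_add, AddMonoidHom.map_add, re_ofReal_mul, AddMonoidHom.map_add]
  ring

/-- **HYPOTHESIS (L) ASSEMBLED from the three certified pieces (D2-CHAIN-MAP S4+S5+S7 ⇒ S8).**
In the setting of `re_inner_weight_apply_eq` (plus `Ks ⟂ Kd`), suppose
* HEAD (the certified `N′ = Herm(G X)|_{≤K} − ηₕ E_K ≽ 0`, written as a form inequality):
  `Re⟪Gₕ h, A h⟫ − ω Re⟪Gₕ h, h⟫ ≤ −ηₕ ‖k‖²` for `h = i + k`, `Gₕ h = Gᵢ i + W k`;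
* CROSS (the certified ball Gram bound `b`): `|Re⟪W k, A s⟫ + τ Re⟪s, A k⟫| ≤ b ‖k‖ ‖s‖`;
* TAIL (the analytic tail levels, `ηₜ`): `Re⟪t, A t⟫ − ω ‖t‖² ≤ −ηₜ ‖t‖²` for `t = s + d`;
* `0 ≤ τ`, `0 ≤ ηₕ`, `0 ≤ ηₜ` and the (non-strict) pivot condition `b² ≤ 4 ηₕ (τ ηₜ)`
  (equality is the driver's `ηₕ = corr = b²/(4 τ ηₜ)`).
Then `Re⟪G w, A w⟫ ≤ ω · Re⟪G w, w⟫` for `w = i + k + s + d`, `G w = Gᵢ i + W k + τ t` — the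
hypothesis `hL` of `LyapunovSkewCutSemigroup.norm_le_of_generator_form` at this `w`. -/
theorem re_inner_weight_generator_le
    (h_is : Ki ⟂ Ks) (h_id : Ki ⟂ Kd) (h_ks : Kk ⟂ Ks) (h_kd : Kk ⟂ Kd) (h_sd : Ks ⟂ Kd)
    {A Gi W : E →ₗ[𝕜] E} (hGi : ∀ x ∈ Ki, Gi x ∈ Ki) (hW : ∀ x ∈ Kk, W x ∈ Kk)
    (hA_id : ∀ x ∈ Ki, ∀ y ∈ Kd, ⟪x, A y⟫_𝕜 = 0) (hA_di : ∀ x ∈ Kd, ∀ y ∈ Ki, ⟪x, A y⟫_𝕜 = 0)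
    (hA_kd : ∀ x ∈ Kk, ∀ y ∈ Kd, ⟪x, A y⟫_𝕜 = 0) (hA_dk : ∀ x ∈ Kd, ∀ y ∈ Kk, ⟪x, A y⟫_𝕜 = 0)
    (hA_is : ∀ x ∈ Ki, ∀ y ∈ Ks, ⟪x, A y⟫_𝕜 = 0) (hA_si : ∀ x ∈ Ks, ∀ y ∈ Ki, ⟪x, A y⟫_𝕜 = 0)
    {τ ω ηh ηt b : ℝ} (hτ : 0 ≤ τ) (hηh : 0 ≤ ηh) (hηt : 0 ≤ ηt) (hpiv : b ^ 2 ≤ 4 * ηh * (τ * ηt))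
    {i k s d : E} (hi : i ∈ Ki) (hk : k ∈ Kk) (hs : s ∈ Ks) (hd : d ∈ Kd)
    (hH : re ⟪Gi i + W k, A (i + k)⟫_𝕜 - ω * re ⟪Gi i + W k, i + k⟫_𝕜 ≤ -ηh * ‖k‖ ^ 2)
    (hC : |re ⟪W k, A s⟫_𝕜 + τ * re ⟪s, A k⟫_𝕜| ≤ b * ‖k‖ * ‖s‖)
    (hT : re ⟪s + d, A (s + d)⟫_𝕜 - ω * ‖s + d‖ ^ 2 ≤ -ηt * ‖s + d‖ ^ 2) :
    re ⟪Gi i + W k + ((τ : 𝕜) • (s + d)), A (i + k + s + d)⟫_𝕜 ≤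
      ω * re ⟪Gi i + W k + ((τ : 𝕜) • (s + d)), i + k + s + d⟫_𝕜 := by
  rw [re_inner_weight_apply_eq hGi hW hA_id hA_di hA_kd hA_dk hA_is hA_si τ hi hk hs hd,
    re_inner_weight_self_eq h_is h_id h_ks h_kd hGi hW τ hi hk hs hd]
  have hPy : ‖s + d‖ ^ 2 = ‖s‖ ^ 2 + ‖d‖ ^ 2 := norm_sq_tail_eq (h_sd.inner_eq hs hd)
  -- the tail form, scaled by `τ ≥ 0`, and weakened from `‖t‖²` to `‖s‖²`
  have hT' : τ * re ⟪s + d, A (s + d)⟫_𝕜 - ω * (τ * ‖s + d‖ ^ 2) ≤ -(τ * ηt) * ‖s‖ ^ 2 := by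
    have h1 : τ * (re ⟪s + d, A (s + d)⟫_𝕜 - ω * ‖s + d‖ ^ 2) ≤ τ * (-ηt * ‖s + d‖ ^ 2) :=
      mul_le_mul_of_nonneg_left hT hτ
    have h2 : τ * (-ηt * ‖s + d‖ ^ 2) ≤ -(τ * ηt) * ‖s‖ ^ 2 := by
      rw [hPy]
      have : 0 ≤ τ * ηt * ‖d‖ ^ 2 := by positivity
      nlinarith
    nlinarith
  have hcross := (le_abs_self _).trans hC
  have hq := neg_quad_add_cross_nonpos (a := ‖k‖) (c := ‖s‖) hηh (mul_nonneg hτ hηt) hpiv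
  nlinarith [hH, hT', hcross, hq]

end Bookkeeping

end Summit.NavierStokesRegularity.FluidComputer.ShellBlockLyapunovForm

end
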